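import Literature.NumberTheory.Automorphic.LeviConstantTermIdeal
import Literature.NumberTheory.Automorphic.HarishChandraParabolicDecompositionGL
import Literature.NumberTheory.Automorphic.HarishChandraFinitenessGLCuspidalTwist
import Literature.NumberTheory.Automorphic.HarishChandraFinitenessGLIdealOfCharacter
import Literature.NumberTheory.Automorphic.HarishChandraFinitenessGLOneCorollaries
import Literature.NumberTheory.Automorphic.AutomorphicFormsSpan
import Literature.NumberTheory.Automorphic.AutomorphicFormsGLTranslates
import Literature.LinearAlgebra.Subspace.SeparatelySpannedFunctions
import HarnessLib

/-!
# Harish-Chandra's finiteness theorem for `GL_n` over a number field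
(Borel–Jacquet 1979, 4.3 (i); Harish-Chandra 1968, Thm. 1; Moeglin–Waldspurger 1995, I.2.17)

Topic `NumberTheory/Automorphic`. **Discharge of the named fact `harishChandra_finiteness_gl`** of
`AutomorphicRepsGL` (and of `harishChandra_finiteness` of `LangAutomorphicForms`, and of
`automorphicRep_isAdmissible`, Borel–Jacquet 4.5): for `U` a level, `θ` a character of
`Z(𝔤𝔩_n(K_∞))` and `M` a finite-dimensional right `K_∞`-stable space of functions on `K_∞`, the
automorphic forms on `GL_n(𝔸_K)` of level `U`, character `θ` and `K_∞`-slices in `M` span a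
finite-dimensional space.

The proof is the classical induction over the maximal parabolics `P_k = N_k M_k`, `0 < k < n`
(Harish-Chandra 1968, §4; Moeglin–Waldspurger I.2.17; Borel–Jacquet 4.3–4.4), assembled from the
tree:

1. `hcSubmodule` — the set `S(U, θ, M)` is a subspace (`IsAutomorphicForm.add_of_top`, the word
   action is linear on smooth functions);
2. the constant terms `φ ↦ φ_{P_k}` (`blockCT`, for a fixed additive Haar measure on the box) give a
   linear map `Φ : S → ∏_{0<k<n} (GL_n(𝔸_K) → ℂ)`; its **kernel consists of cusp forms**
   (`cuspConditionGL_of_blockCT_eq_zero`) of level `U`, character `θ`, slices in `M`, a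
   finite-dimensional space by the cuspidal case
   `finiteDimensional_span_cuspForms_of_hasZCharacter'` (Gelfand–Piatetski-Shapiro compactness);
3. **each coordinate `φ_{P_k}` ranges in a finite-dimensional space**
   (`finiteDimensional_span_image_blockCT`, `n = k + l`): `φ_P` is determined by the functions
   `F_{κ,t}(m₁, m₂) = φ_P(diag(m₁, m₂) κ x_t)` for finitely many `κ ∈ GL_n(𝒪̂_K)`
   (`exists_finset_coset_representatives`) and finitely many `x_t ∈ K_∞` detecting `M`
   (`exists_points_eval_injective`), by `GL = N M K_∞ GL(𝒪̂)`
   (`exists_unipotent_leviGL_maximalCompact_eq`), the `N(𝔸)`-invariance of `φ_P` and its level;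
   and `F_{κ,t}` has its partial functions in the spaces of automorphic forms on `GL_k` resp. `GL_l`
   of a fixed level, killed by an ideal of finite codimension of `Z(𝔪)` (`LeviConstantTermIdeal`,
   for the character `θ_t` of the `x_t`-translate, `HasZCharacter.archTranslate`) and with slices
   in a fixed finite-dimensional space (`LeviConstantTermForms`) — finite-dimensional by the
   induction hypothesis in the ideal form (`harishChandra_finiteness`,
   `harishChandra_finiteness_iff_harishChandra_finiteness_gl`) — so that the `F_{κ,t}` lie in a
   finite-dimensional space (`finiteDimensional_span_setOf_sections`);
4. `harishChandra_finiteness_gl_holds` — the induction (`n = 0` trivial, `n = 1`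
   `harishChandra_finiteness_gl_glOne`), `harishChandra_finiteness_holds`, and
   `automorphicRep_isAdmissible_holds` (`automorphicRep_isAdmissible_of_harishChandra_finiteness_gl`).

## References

* A. Borel, H. Jacquet, *Automorphic forms and automorphic representations*, Proc. Sympos. Pure
  Math. 33 (1979), part 1, 4.3–4.5 [BorelJacquet1979].
* Harish-Chandra, *Automorphic forms on semisimple Lie groups*, LNM 62 (1968), Thm. 1 and §4
  [HarishChandra1968].
* C. Moeglin, J.-L. Waldspurger, *Spectral decomposition and Eisenstein series* (1995), I.2.17
  [MoeglinWaldspurger1995].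
-/

-- Mathlib idiom (Mathlib/Algebra/Lie/OfAssociative.lean); needed to mention Lie subalgebras of matrix algebras
attribute [local instance 100] LieRing.ofAssociativeRing

noncomputable section

open scoped Matrix MatrixGroups Classical ContDiff Polynomial RestrictedProduct
open NumberField IsDedekindDomain NumberField.mixedEmbedding UniversalEnvelopingAlgebra
open _root_.MeasureTheory _root_.MeasureTheory.Measure Literature.LinearAlgebra.Subspace

namespace Literature.NumberTheory.Automorphic

/-! ### 1. Characters of archimedean translates (general archimedean datum) -/

section Character

variable {A : Type*} [NormedCommRing A] [NormedAlgebra ℝ A] [NormedAlgebra ℚ A] [CompleteSpace A]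
  [StarRing A] {N : Type*} [Fintype N] [DecidableEq N] {H : RealMatrixGroup A N}
  {G : Type*} [Group G] (ι : H.carrier →* G)

/-- `freeToEnveloping` is surjective (the proof of `freeToEnveloping_surjective` of
`AutomorphicRepsGLCuspidalSpectralSupport`, not imported). Dixmier, 2.1.1. [folklore] -/
private theorem freeToEnveloping_surjective₃ : Function.Surjective (freeToEnveloping H) := by
  have hrange : (freeToEnveloping H).range = ⊤ := by
    rw [freeToEnveloping, ← Algebra.adjoin_range_eq_range_freeAlgebra_lift]
    have hι : Set.range (UniversalEnvelopingAlgebra.ι ℝ : H.lie → UniversalEnvelopingAlgebra ℝ H.lie) =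
        UniversalEnvelopingAlgebra.mkAlgHom ℝ H.lie '' Set.range (TensorAlgebra.ι ℝ (M := H.lie)) := by
      rw [← Set.range_comp]
      rfl
    rw [hι, ← AlgHom.map_adjoin, TensorAlgebra.adjoin_range_ι, Algebra.map_top, AlgHom.range_eq_top]
    exact RingCon.mkₐ_surjective _
  intro u
  have hu : u ∈ (freeToEnveloping H).range := hrange ▸ Algebra.mem_top
  exact hu

variable (H) in
/-- `U(Ad h⁻¹)` maps the centre `Z(𝔤)` into itself (an automorphism of `U(𝔤)` preserves the
centre; `isCentralWord_lift_Ad`). [folklore] -/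
theorem lift_Ad_inv_mem_centerU (h : H.carrier) {z : UniversalEnvelopingAlgebra ℝ H.lie} (hz : z ∈ centerU H) :
    UniversalEnvelopingAlgebra.lift ℝ ((UniversalEnvelopingAlgebra.ι ℝ).comp (H.Ad h⁻¹ : H.lie →ₗ⁅ℝ⁆ H.lie)) z ∈
      centerU H := by
  obtain ⟨p, rfl⟩ := freeToEnveloping_surjective₃ (H := H) z
  rw [← freeToEnveloping_lift_Ad]
  exact isCentralWord_lift_Ad h⁻¹ hz

variable (H) in
/-- **`Ad h⁻¹` on the centre `Z(𝔤)`**, as an algebra endomorphism of `Z(𝔤)`. [folklore] -/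
def adCenterInv (h : H.carrier) : centerU H →ₐ[ℝ] centerU H :=
  AlgHom.codRestrict
    ((UniversalEnvelopingAlgebra.lift ℝ ((UniversalEnvelopingAlgebra.ι ℝ).comp (H.Ad h⁻¹ : H.lie →ₗ⁅ℝ⁆ H.lie))).comp
      (centerU H).val) (centerU H) fun z => lift_Ad_inv_mem_centerU H h z.2

/-- `adCenterInv` on a central element. [folklore] -/
theorem coe_adCenterInv (h : H.carrier) (z : centerU H) :
    ((adCenterInv H h z : centerU H) : UniversalEnvelopingAlgebra ℝ H.lie) =
      UniversalEnvelopingAlgebra.lift ℝ ((UniversalEnvelopingAlgebra.ι ℝ).comp (H.Ad h⁻¹ : H.lie →ₗ⁅ℝ⁆ H.lie)) z :=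
  rfl

/-- **The character of an archimedean right translate**: if `φ` has `Z(𝔤)`-character `θ`, then
`r(h) φ = (g ↦ φ (g ι(h)))` has `Z(𝔤)`-character `θ ∘ Ad h⁻¹` (`z (r(h) φ) = r(h) ((Ad h⁻¹ z) φ)`,
`applyFree_archTranslate`). Borel–Jacquet 1979, §1.6 and 4.3 (ii); Borel 1997, 2.16.
[cite: BorelJacquet1979, 4.3 (ii)] -/
theorem HasZCharacter.archTranslate {φ : G → ℂ} {θ : centerU H →ₐ[ℝ] ℂ} (hθ : HasZCharacter ι φ θ)
    (h : H.carrier) : HasZCharacter ι (archTranslate ι h φ) (θ.comp (adCenterInv H h)) := by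
  intro p hp
  rw [applyFree_archTranslate, hθ _ (isCentralWord_lift_Ad h⁻¹ hp), map_smul, AlgHom.comp_apply]
  congr 2
  exact Subtype.ext (freeToEnveloping_lift_Ad h⁻¹ p)

end Character

variable {K : Type} [Field K] [NumberField K]

/-! ### 2. The space `S(U, θ, M)` and its linear structure -/

section Space

variable {n : ℕ}

/-- The set of automorphic forms on `GL_n(𝔸_K)` of level `U`, `Z(𝔤)`-character `θ` and
`K_∞`-slices in `M` (the set spanned in `harishChandra_finiteness_gl`). [cite: BorelJacquet1979, 4.3 (i)] -/
def hcSet (hcpt : isCompact_glFiniteIntegralLevel n K) (U : Subgroup (GL (Fin n) (AdeleRing (𝓞 K) K)))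
    (θ : centerU (archGroupGL n K) →ₐ[ℝ] ℂ) (M : Submodule ℂ (Kinf n K → ℂ)) :
    Set ((AdelicGroupData.gl n K).Adelic → ℂ) :=
  {φ | IsAutomorphicForm (AutomorphyDatum.gl n K hcpt) φ ∧ IsRightInvariantUnder U φ ∧
    HasZCharacter (AutomorphyDatum.gl n K hcpt).ofArch φ θ ∧
    ∀ g : (AdelicGroupData.gl n K).Adelic, (fun k : Kinf n K => φ (g * (AutomorphyDatum.gl n K hcpt).ofK k)) ∈ M}

/-- `S(U, θ, M)` is closed under addition. [cite: BorelJacquet1979, 4.3] -/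
theorem hcSet_add {hcpt : isCompact_glFiniteIntegralLevel n K} {U : Subgroup (GL (Fin n) (AdeleRing (𝓞 K) K))}
    {θ : centerU (archGroupGL n K) →ₐ[ℝ] ℂ} {M : Submodule ℂ (Kinf n K → ℂ)}
    {φ ψ : (AdelicGroupData.gl n K).Adelic → ℂ} (hφ : φ ∈ hcSet hcpt U θ M) (hψ : ψ ∈ hcSet hcpt U θ M) :
    φ + ψ ∈ hcSet hcpt U θ M := by
  have hH : (AutomorphyDatum.gl n K hcpt).arch.lie = ⊤ := archGroupGL_lie n K
  have hc : (AutomorphyDatum.gl n K hcpt).arch.carrier = ⊤ := archGroupGL_carrier n K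
  refine ⟨hφ.1.add_of_top hH hc (directedOn_finiteLevels_gl hcpt) hψ.1, fun u hu g => ?_, fun p hp => ?_, fun g => ?_⟩
  · simp only [Pi.add_apply, hφ.2.1 u hu g, hψ.2.1 u hu g]
  · rw [applyFree_add_right_of_top _ hH hc p hφ.1.archSmooth hψ.1.archSmooth, hφ.2.2.1 p hp, hψ.2.2.1 p hp,
      smul_add]
  · exact M.add_mem (hφ.2.2.2 g) (hψ.2.2.2 g)

/-- `S(U, θ, M)` is closed under scalar multiplication. [cite: BorelJacquet1979, 4.3] -/
theorem hcSet_smul {hcpt : isCompact_glFiniteIntegralLevel n K} {U : Subgroup (GL (Fin n) (AdeleRing (𝓞 K) K))}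
    {θ : centerU (archGroupGL n K) →ₐ[ℝ] ℂ} {M : Submodule ℂ (Kinf n K → ℂ)} (c : ℂ)
    {φ : (AdelicGroupData.gl n K).Adelic → ℂ} (hφ : φ ∈ hcSet hcpt U θ M) : c • φ ∈ hcSet hcpt U θ M := by
  refine ⟨hφ.1.smul c, fun u hu g => ?_, fun p hp => ?_, fun g => ?_⟩
  · simp only [Pi.smul_apply, hφ.2.1 u hu g]
  · rw [applyFree_smul_right, hφ.2.2.1 p hp, smul_comm]
  · exact M.smul_mem c (hφ.2.2.2 g)

/-- The zero function lies in `S(U, θ, M)`. [cite: BorelJacquet1979, 4.3] -/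
theorem zero_mem_hcSet {hcpt : isCompact_glFiniteIntegralLevel n K} {U : Subgroup (GL (Fin n) (AdeleRing (𝓞 K) K))}
    {θ : centerU (archGroupGL n K) →ₐ[ℝ] ℂ} {M : Submodule ℂ (Kinf n K → ℂ)} :
    (0 : (AdelicGroupData.gl n K).Adelic → ℂ) ∈ hcSet hcpt U θ M :=
  ⟨isAutomorphicForm_zero _, fun _ _ _ => rfl, fun p hp => by rw [applyFree_zero_right, smul_zero],
    fun _ => M.zero_mem⟩

/-- **`S(U, θ, M)` is a subspace**: automorphic forms on `GL_n` form a vector space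
(`IsAutomorphicForm.add_of_top`), the level and slice conditions are linear, and so is the character
condition on smooth functions (`applyFree_add_right_of_top`). Borel–Jacquet 1979, 4.3.
[cite: BorelJacquet1979, 4.3] -/
def hcSubmodule (hcpt : isCompact_glFiniteIntegralLevel n K) (U : Subgroup (GL (Fin n) (AdeleRing (𝓞 K) K)))
    (θ : centerU (archGroupGL n K) →ₐ[ℝ] ℂ) (M : Submodule ℂ (Kinf n K → ℂ)) :
    Submodule ℂ ((AdelicGroupData.gl n K).Adelic → ℂ) where
  carrier := hcSet hcpt U θ M
  zero_mem' := zero_mem_hcSet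
  add_mem' := hcSet_add
  smul_mem' := hcSet_smul

/-- The span of `S(U, θ, M)` is `S(U, θ, M)`. [folklore] -/
theorem span_hcSet_eq (hcpt : isCompact_glFiniteIntegralLevel n K) (U : Subgroup (GL (Fin n) (AdeleRing (𝓞 K) K)))
    (θ : centerU (archGroupGL n K) →ₐ[ℝ] ℂ) (M : Submodule ℂ (Kinf n K → ℂ)) :
    Submodule.span ℂ (hcSet hcpt U θ M) = hcSubmodule hcpt U θ M :=
  Submodule.span_eq (hcSubmodule hcpt U θ M)

end Space

/-! ### 3. Translates of elements of `S(U, θ, M)` -/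

section Translates

variable {n : ℕ} {hcpt : isCompact_glFiniteIntegralLevel n K}

/-- `ofK` of the `GL_n` datum is `GLn.ofInfinite` on `K_∞` (private copy of the lemma of
`AutomorphicRepsGLCuspidalKFiniteGarding`, not imported). [folklore] -/
private theorem AutomorphyDatum.gl_ofK_apply' (c : Kinf n K) :
    (AutomorphyDatum.gl n K hcpt).ofK c = GLn.ofInfinite n K (c : GL (Fin n) (mixedSpace K)) :=
  rfl

/-- The translate `g ↦ φ (g · (1, κ) · (x, 1))` of a function on `GL_n(𝔸_K)` by a finite-adelic
element `κ` and an element `x ∈ K_∞`. [folklore] -/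
def translateKF (φ : GL (Fin n) (AdeleRing (𝓞 K) K) → ℂ) (κ : GL (Fin n) (FiniteAdeleRing (𝓞 K) K)) (x : Kinf n K) :
    GL (Fin n) (AdeleRing (𝓞 K) K) → ℂ :=
  fun g => φ (g * (GLn.ofFinite n K κ * GLn.ofInfinite n K (x : GL (Fin n) (mixedSpace K))))

/-- Unfolding of `translateKF`. [folklore] -/
@[simp]
theorem translateKF_apply (φ : GL (Fin n) (AdeleRing (𝓞 K) K) → ℂ) (κ : GL (Fin n) (FiniteAdeleRing (𝓞 K) K))
    (x : Kinf n K) (g : GL (Fin n) (AdeleRing (𝓞 K) K)) :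
    translateKF φ κ x g = φ (g * (GLn.ofFinite n K κ * GLn.ofInfinite n K (x : GL (Fin n) (mixedSpace K)))) :=
  rfl

/-- **A finite-adelic translate followed by a `K_∞`-translate of an element of `S(U, θ, M)`** is an
automorphic form, right invariant under the conjugated level, of character `θ ∘ Ad x⁻¹`, with slices
in `M` (`M` right `K_∞`-stable). Borel–Jacquet 1979, 4.3 (ii). [cite: BorelJacquet1979, 4.3 (ii)] -/
theorem translateKF_mem {U₀ : Subgroup (GL (Fin n) (FiniteAdeleRing (𝓞 K) K))}
    {θ : centerU (archGroupGL n K) →ₐ[ℝ] ℂ} {M : Submodule ℂ (Kinf n K → ℂ)}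
    (hM : ∀ k₀ : Kinf n K, ∀ f ∈ M, (fun k => f (k * k₀)) ∈ M)
    {φ : GL (Fin n) (AdeleRing (𝓞 K) K) → ℂ} (hφ : φ ∈ hcSet hcpt (U₀.map (GLn.ofFinite n K)) θ M)
    (κ : GL (Fin n) (FiniteAdeleRing (𝓞 K) K)) (x : Kinf n K) :
    IsAutomorphicForm (AutomorphyDatum.gl n K hcpt) (translateKF φ κ x) ∧
      IsRightInvariantUnder ((U₀.map (MulAut.conj κ).toMonoidHom).map (GLn.ofFinite n K)) (translateKF φ κ x) ∧
      HasZCharacter (glArch n K) (translateKF φ κ x)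
        (θ.comp (adCenterInv (archGroupGL n K) ⟨(x : GL (Fin n) (mixedSpace K)), Subgroup.mem_top _⟩)) ∧
      ∀ g : GL (Fin n) (AdeleRing (𝓞 K) K),
        (fun c : Kinf n K => translateKF φ κ x (g * GLn.ofInfinite n K (c : GL (Fin n) (mixedSpace K)))) ∈ M := by
  obtain ⟨hφa, hφU, hφθ, hφM⟩ := hφ
  -- the finite-adelic translate
  set φ₁ : GL (Fin n) (AdeleRing (𝓞 K) K) → ℂ := fun g => φ (g * GLn.ofFinite n K κ) with hφ₁
  have hφ₁a : IsAutomorphicForm (AutomorphyDatum.gl n K hcpt) φ₁ :=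
    hφa.rightTranslation_gl (y := GLn.ofFinite n K κ) ⟨κ, rfl⟩
  have hφ₁U : IsRightInvariantUnder ((U₀.map (MulAut.conj κ).toMonoidHom).map (GLn.ofFinite n K)) φ₁ := by
    refine IsRightInvariantUnder.rightTranslation (𝒢 := AdelicGroupData.gl n K) hφU ?_
    rintro _ ⟨_, ⟨u₀, hu₀, rfl⟩, rfl⟩
    refine ⟨u₀, hu₀, ?_⟩
    change GLn.ofFinite n K u₀ = (GLn.ofFinite n K κ)⁻¹ * GLn.ofFinite n K (MulAut.conj κ u₀) * GLn.ofFinite n K κ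
    rw [MulAut.conj_apply, map_mul, map_mul, map_inv]
    group
  have hcomm : ∀ h : (archGroupGL n K).carrier, glArch n K h * GLn.ofFinite n K κ = GLn.ofFinite n K κ * glArch n K h :=
    fun h => (AutomorphyDatum.gl n K hcpt).commute_ofArch h _ ⟨κ, rfl⟩
  have hφ₁θ : HasZCharacter (glArch n K) φ₁ θ := by
    intro p hp
    have h2 : applyFree (glArch n K) p φ = θ ⟨freeToEnveloping (archGroupGL n K) p, hp⟩ • φ := hφθ p hp
    rw [hφ₁, applyFree_comp_mul_right (glArch n K) p φ hcomm, h2]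
    rfl
  have hφ₁M : ∀ g : GL (Fin n) (AdeleRing (𝓞 K) K),
      (fun c : Kinf n K => φ₁ (g * GLn.ofInfinite n K (c : GL (Fin n) (mixedSpace K)))) ∈ M := by
    intro g
    have h : (fun c : Kinf n K => φ (g * GLn.ofFinite n K κ * GLn.ofInfinite n K (c : GL (Fin n) (mixedSpace K)))) ∈ M :=
      hφM (g * GLn.ofFinite n K κ)
    have e : (fun c : Kinf n K => φ₁ (g * GLn.ofInfinite n K (c : GL (Fin n) (mixedSpace K)))) =
        fun c : Kinf n K => φ (g * GLn.ofFinite n K κ * GLn.ofInfinite n K (c : GL (Fin n) (mixedSpace K))) := by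
      funext c
      rw [hφ₁]
      change φ (g * GLn.ofInfinite n K (c : GL (Fin n) (mixedSpace K)) * GLn.ofFinite n K κ) = _
      rw [mul_assoc, GLn.commute_ofInfinite_ofFinite, ← mul_assoc]
    rw [e]
    exact h
  -- the `K_∞`-translate
  set xh : (archGroupGL n K).carrier := ⟨(x : GL (Fin n) (mixedSpace K)), Subgroup.mem_top _⟩ with hxh
  have hφ' : translateKF φ κ x = archTranslate (glArch n K) xh φ₁ := by
    funext g
    rw [archTranslate_apply, translateKF_apply, hφ₁, glArch_apply]
    change _ = φ (g * GLn.ofInfinite n K (x : GL (Fin n) (mixedSpace K)) * GLn.ofFinite n K κ)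
    rw [mul_assoc, GLn.commute_ofInfinite_ofFinite]
  refine ⟨?_, ?_, ?_, ?_⟩
  · -- automorphic: a `K_∞`-translate of an automorphic form
    rw [hφ']
    exact isAutomorphicForm_rightTranslation_ofK_gl hφ₁a x
  · rintro _ ⟨_, ⟨u₀, hu₀, rfl⟩, rfl⟩ g
    have e : g * GLn.ofFinite n K ((MulAut.conj κ).toMonoidHom u₀) *
        (GLn.ofFinite n K κ * GLn.ofInfinite n K (x : GL (Fin n) (mixedSpace K))) =
        g * (GLn.ofFinite n K κ * GLn.ofInfinite n K (x : GL (Fin n) (mixedSpace K))) * GLn.ofFinite n K u₀ := by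
      change g * GLn.ofFinite n K (κ * u₀ * κ⁻¹) * _ = _
      rw [map_mul, map_mul, map_inv]
      simp only [mul_assoc, inv_mul_cancel_left]
      rw [(GLn.commute_ofInfinite_ofFinite (x : GL (Fin n) (mixedSpace K)) u₀).eq]
    rw [translateKF_apply, translateKF_apply, e]
    exact hφU _ ⟨u₀, hu₀, rfl⟩ _
  · rw [hφ']
    exact hφ₁θ.archTranslate (glArch n K) xh
  · intro g
    have h := hM x _ (hφ₁M g)
    have e : (fun c : Kinf n K => translateKF φ κ x (g * GLn.ofInfinite n K (c : GL (Fin n) (mixedSpace K)))) =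
        fun c : Kinf n K => φ₁ (g * GLn.ofInfinite n K ((c * x : Kinf n K) : GL (Fin n) (mixedSpace K))) := by
      funext c
      rw [translateKF_apply, hφ₁, Subgroup.coe_mul, map_mul]
      simp only [mul_assoc]
      rw [← (GLn.commute_ofInfinite_ofFinite (x : GL (Fin n) (mixedSpace K)) κ).eq]
    rw [e]
    exact h

end Translates




/-! ### 4. Levels, spaces and sections on the Levi factors -/

section Levi

variable [MeasurableSpace (AdeleRing (𝓞 K) K)] [BorelSpace (AdeleRing (𝓞 K) K)] {k l : ℕ}

omit [MeasurableSpace (AdeleRing (𝓞 K) K)] [BorelSpace (AdeleRing (𝓞 K) K)] in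
/-- `GL_n(𝔸_K^∞)` is Hausdorff. [folklore] -/
private theorem t2Space_gl_finiteAdeleRing₃ (m : ℕ) : T2Space (GL (Fin m) (FiniteAdeleRing (𝓞 K) K)) := by
  haveI : T2Space (FiniteAdeleRing (𝓞 K) K) := inferInstanceAs <| T2Space
    (Πʳ w : HeightOneSpectrum (𝓞 K), [w.adicCompletion K, w.adicCompletionIntegers K])
  infer_instance

/-- The level `(1, GL_k(𝒪̂_K) ∩ {u | diag(u, 1) ∈ U₀'})` of `GL_k(𝔸_K)` cut out by a subgroup
`U₀' ≤ GL_{k+l}(𝔸_K^∞)` (the level of `exists_level_leviFunLeft`, made explicit). [folklore] -/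
def leviLevelLeft (k l : ℕ) (U₀' : Subgroup (GL (Fin (k + l)) (FiniteAdeleRing (𝓞 K) K))) :
    Subgroup (GL (Fin k) (AdeleRing (𝓞 K) K)) :=
  (glFiniteIntegralLevel k K ⊓ U₀'.comap ((leviGL (FiniteAdeleRing (𝓞 K) K) k l).comp (MonoidHom.inl _ _))).map
    (GLn.ofFinite k K)

/-- The level `(1, GL_l(𝒪̂_K) ∩ {u | diag(1, u) ∈ U₀'})` of `GL_l(𝔸_K)`. [folklore] -/
def leviLevelRight (k l : ℕ) (U₀' : Subgroup (GL (Fin (k + l)) (FiniteAdeleRing (𝓞 K) K))) :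
    Subgroup (GL (Fin l) (AdeleRing (𝓞 K) K)) :=
  (glFiniteIntegralLevel l K ⊓ U₀'.comap ((leviGL (FiniteAdeleRing (𝓞 K) K) k l).comp (MonoidHom.inr _ _))).map
    (GLn.ofFinite l K)

omit [MeasurableSpace (AdeleRing (𝓞 K) K)] [BorelSpace (AdeleRing (𝓞 K) K)] in
/-- `leviLevelLeft` is an admissible level of `GL_k` for `U₀'` compact open. [cite: BorelJacquet1979, 4.4] -/
theorem leviLevelLeft_mem {U₀' : Subgroup (GL (Fin (k + l)) (FiniteAdeleRing (𝓞 K) K))}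
    (hU₀o : IsOpen (U₀' : Set (GL (Fin (k + l)) (FiniteAdeleRing (𝓞 K) K))))
    (hU₀c : IsCompact (U₀' : Set (GL (Fin (k + l)) (FiniteAdeleRing (𝓞 K) K)))) :
    leviLevelLeft k l U₀' ∈ finiteLevelsGL k K := by
  haveI := t2Space_gl_finiteAdeleRing₃ (K := K) (k + l)
  have hjc : Continuous ((leviGL (FiniteAdeleRing (𝓞 K) K) k l).comp (MonoidHom.inl _ (GL (Fin l) (FiniteAdeleRing (𝓞 K) K)))) :=
    continuous_leviGL.comp (continuous_id.prodMk continuous_const)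
  refine ⟨_, (isOpen_glFiniteIntegralLevel k K).inter (hU₀o.preimage hjc), ?_, rfl⟩
  exact (show IsCompact (glFiniteIntegralLevel k K : Set (GL (Fin k) (FiniteAdeleRing (𝓞 K) K))) from
    isCompact_glFiniteIntegralLevel_holds k K).inter_right (hU₀c.isClosed.preimage hjc)

omit [MeasurableSpace (AdeleRing (𝓞 K) K)] [BorelSpace (AdeleRing (𝓞 K) K)] in
/-- `leviLevelRight` is an admissible level of `GL_l` for `U₀'` compact open. [cite: BorelJacquet1979, 4.4] -/
theorem leviLevelRight_mem {U₀' : Subgroup (GL (Fin (k + l)) (FiniteAdeleRing (𝓞 K) K))}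
    (hU₀o : IsOpen (U₀' : Set (GL (Fin (k + l)) (FiniteAdeleRing (𝓞 K) K))))
    (hU₀c : IsCompact (U₀' : Set (GL (Fin (k + l)) (FiniteAdeleRing (𝓞 K) K)))) :
    leviLevelRight k l U₀' ∈ finiteLevelsGL l K := by
  haveI := t2Space_gl_finiteAdeleRing₃ (K := K) (k + l)
  have hjc : Continuous ((leviGL (FiniteAdeleRing (𝓞 K) K) k l).comp (MonoidHom.inr (GL (Fin k) (FiniteAdeleRing (𝓞 K) K)) _)) :=
    continuous_leviGL.comp (continuous_const.prodMk continuous_id)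
  refine ⟨_, (isOpen_glFiniteIntegralLevel l K).inter (hU₀o.preimage hjc), ?_, rfl⟩
  exact (show IsCompact (glFiniteIntegralLevel l K : Set (GL (Fin l) (FiniteAdeleRing (𝓞 K) K))) from
    isCompact_glFiniteIntegralLevel_holds l K).inter_right (hU₀c.isClosed.preimage hjc)

omit [MeasurableSpace (AdeleRing (𝓞 K) K)] [BorelSpace (AdeleRing (𝓞 K) K)] in
/-- The first Levi function of a right `(1, U₀')`-invariant function is right `leviLevelLeft U₀'`-invariant.
[cite: BorelJacquet1979, 4.4] -/
theorem isRightInvariantUnder_leviLevelLeft {U₀' : Subgroup (GL (Fin (k + l)) (FiniteAdeleRing (𝓞 K) K))}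
    {ψ : GL (Fin (k + l)) (AdeleRing (𝓞 K) K) → ℂ} (hψU : IsRightInvariantUnder (U₀'.map (GLn.ofFinite (k + l) K)) ψ)
    (m₂ : GL (Fin l) (AdeleRing (𝓞 K) K)) : IsRightInvariantUnder (leviLevelLeft k l U₀') (leviFunLeft ψ m₂) := by
  rintro _ ⟨u, hu, rfl⟩ m₁
  rw [leviFunLeft_apply, leviFunLeft_apply]
  have e : leviGL (AdeleRing (𝓞 K) K) k l (m₁ * GLn.ofFinite k K u, m₂) =
      leviGL (AdeleRing (𝓞 K) K) k l (m₁, m₂) *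
        GLn.ofFinite (k + l) K (((leviGL (FiniteAdeleRing (𝓞 K) K) k l).comp (MonoidHom.inl _ _)) u) := by
    rw [MonoidHom.comp_apply, MonoidHom.inl_apply, GLn.ofFinite_leviGL, map_one, ← map_mul, Prod.mk_mul_mk, mul_one]
  rw [e]
  exact hψU _ ⟨_, (Subgroup.mem_inf.mp hu).2, rfl⟩ _

omit [MeasurableSpace (AdeleRing (𝓞 K) K)] [BorelSpace (AdeleRing (𝓞 K) K)] in
/-- The second Levi function of a right `(1, U₀')`-invariant function is right `leviLevelRight U₀'`-invariant.
[cite: BorelJacquet1979, 4.4] -/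
theorem isRightInvariantUnder_leviLevelRight {U₀' : Subgroup (GL (Fin (k + l)) (FiniteAdeleRing (𝓞 K) K))}
    {ψ : GL (Fin (k + l)) (AdeleRing (𝓞 K) K) → ℂ} (hψU : IsRightInvariantUnder (U₀'.map (GLn.ofFinite (k + l) K)) ψ)
    (m₁ : GL (Fin k) (AdeleRing (𝓞 K) K)) : IsRightInvariantUnder (leviLevelRight k l U₀') (leviFunRight ψ m₁) := by
  rintro _ ⟨u, hu, rfl⟩ m₂
  rw [leviFunRight_apply, leviFunRight_apply]
  have e : leviGL (AdeleRing (𝓞 K) K) k l (m₁, m₂ * GLn.ofFinite l K u) =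
      leviGL (AdeleRing (𝓞 K) K) k l (m₁, m₂) *
        GLn.ofFinite (k + l) K (((leviGL (FiniteAdeleRing (𝓞 K) K) k l).comp (MonoidHom.inr _ _)) u) := by
    rw [MonoidHom.comp_apply, MonoidHom.inr_apply, GLn.ofFinite_leviGL, map_one, ← map_mul, Prod.mk_mul_mk, mul_one]
  rw [e]
  exact hψU _ ⟨_, (Subgroup.mem_inf.mp hu).2, rfl⟩ _

omit [MeasurableSpace (AdeleRing (𝓞 K) K)] [BorelSpace (AdeleRing (𝓞 K) K)] in
/-- Conjugates of compact open subgroups of `GL_n(𝔸_K^∞)` are compact open (cf. `finiteLevelsGL_conj`).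
[folklore] -/
theorem isOpen_isCompact_map_conj {m : ℕ} {U₀ : Subgroup (GL (Fin m) (FiniteAdeleRing (𝓞 K) K))}
    (hU₀o : IsOpen (U₀ : Set (GL (Fin m) (FiniteAdeleRing (𝓞 K) K))))
    (hU₀c : IsCompact (U₀ : Set (GL (Fin m) (FiniteAdeleRing (𝓞 K) K)))) (κ : GL (Fin m) (FiniteAdeleRing (𝓞 K) K)) :
    IsOpen ((U₀.map (MulAut.conj κ).toMonoidHom : Subgroup (GL (Fin m) (FiniteAdeleRing (𝓞 K) K))) :
        Set (GL (Fin m) (FiniteAdeleRing (𝓞 K) K))) ∧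
      IsCompact ((U₀.map (MulAut.conj κ).toMonoidHom : Subgroup (GL (Fin m) (FiniteAdeleRing (𝓞 K) K))) :
        Set (GL (Fin m) (FiniteAdeleRing (𝓞 K) K))) := by
  constructor
  · rw [Subgroup.map_equiv_eq_comap_symm']
    change IsOpen ((fun x => (MulAut.conj κ).symm.toMonoidHom x) ⁻¹' (U₀ : Set _))
    refine hU₀o.preimage ?_
    change Continuous fun x => (MulAut.conj κ).symm x
    simp only [MulAut.conj_symm_apply]
    exact (continuous_const.mul continuous_id).mul continuous_const
  · rw [Subgroup.coe_map]
    refine hU₀c.image ?_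
    change Continuous fun x => MulAut.conj κ x
    simp only [MulAut.conj_apply]
    exact (continuous_const.mul continuous_id).mul continuous_const

/-- The set of `harishChandra_finiteness` (ideal form) on `GL_m(𝔸_K)`: automorphic forms of level `U₁`,
killed by `J`, with `K_∞`-slices in `M₁`. [cite: BorelJacquet1979, 4.3 (i)] -/
def hcJSet {m : ℕ} (hcptm : isCompact_glFiniteIntegralLevel m K) (U₁ : Subgroup (GL (Fin m) (AdeleRing (𝓞 K) K)))
    (J : Ideal (centerU (archGroupGL m K))) (M₁ : Submodule ℂ (Kinf m K → ℂ)) :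
    Set ((AdelicGroupData.gl m K).Adelic → ℂ) :=
  {φ | IsAutomorphicForm (AutomorphyDatum.gl m K hcptm) φ ∧ IsRightInvariantUnder U₁ φ ∧
    (∀ (p : FreeAlgebra ℝ (archGroupGL m K).lie) (hp : IsCentralWord p),
      (⟨freeToEnveloping (archGroupGL m K) p, hp⟩ : centerU (archGroupGL m K)) ∈ J →
        applyFree (AutomorphyDatum.gl m K hcptm).ofArch p φ = 0) ∧
    ∀ g : (AdelicGroupData.gl m K).Adelic, (fun c : Kinf m K => φ (g * (AutomorphyDatum.gl m K hcptm).ofK c)) ∈ M₁}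

omit [MeasurableSpace (AdeleRing (𝓞 K) K)] [BorelSpace (AdeleRing (𝓞 K) K)] in
/-- The ideal form of the finiteness theorem, read as the finite-dimensionality of the span of `hcJSet`.
[cite: BorelJacquet1979, 4.3 (i)] -/
theorem finiteDimensional_span_hcJSet {m : ℕ} {hcptm : isCompact_glFiniteIntegralLevel m K}
    (h : harishChandra_finiteness hcptm) {U₁ : Subgroup (GL (Fin m) (AdeleRing (𝓞 K) K))} (hU₁ : U₁ ∈ finiteLevelsGL m K)
    (J : Ideal (centerU (archGroupGL m K))) [FiniteDimensional ℝ (centerU (archGroupGL m K) ⧸ J)]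
    (M₁ : Submodule ℂ (Kinf m K → ℂ)) [FiniteDimensional ℂ M₁]
    (hM₁ : ∀ k₀ : Kinf m K, ∀ f ∈ M₁, (fun c => f (c * k₀)) ∈ M₁) :
    FiniteDimensional ℂ (Submodule.span ℂ (hcJSet hcptm U₁ J M₁)) :=
  h hU₁ J M₁ hM₁

omit [BorelSpace (AdeleRing (𝓞 K) K)] in
/-- **The first Levi function of a constant term of an automorphic form has moderate growth** (same
exponent; `exists_norm_blockCT_le`, `exists_norm_leviFunLeft_le`). Moeglin–Waldspurger 1995, I.2.2,
I.2.17. [cite: MoeglinWaldspurger1995, I.2.17] -/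
theorem hasModerateGrowth_leviFunLeft_blockCT [NeZero k] [NeZero l] {hcpt : isCompact_glFiniteIntegralLevel (k + l) K}
    {φ' : GL (Fin (k + l)) (AdeleRing (𝓞 K) K) → ℂ} (hφ'a : IsAutomorphicForm (AutomorphyDatum.gl (k + l) K hcpt) φ')
    (ν : Measure (BlockIdx (k + l) k → AdeleRing (𝓞 K) K)) [ν.IsAddHaarMeasure] (m₂ : GL (Fin l) (AdeleRing (𝓞 K) K)) :
    HasModerateGrowth (AutomorphyDatum.gl k K (isCompact_glFiniteIntegralLevel_holds k K))
      (leviFunLeft (blockCT (le_refl (k + l)) k ν φ') m₂) := by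
  obtain ⟨C, r, hC⟩ := hφ'a.moderateGrowth
  have hC' : ∀ g, ‖φ' g‖ ≤ max C 0 * (1 ⊔ adelicHeightGL (k + l) K g) ^ r := by
    intro g
    have h1 : ‖φ' g‖ ≤ C * (1 ⊔ adelicHeightGL (k + l) K g) ^ r := by
      have h := hC g
      rw [AutomorphyDatum.gl_height] at h
      exact h
    have h0 : (0 : ℝ) ≤ (1 ⊔ adelicHeightGL (k + l) K g) ^ r := pow_nonneg (zero_le_one.trans le_sup_left) r
    exact h1.trans (mul_le_mul_of_nonneg_right (le_max_left C 0) h0)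
  obtain ⟨C₁, hC₁⟩ := exists_norm_blockCT_le (n := k + l) (k := k) (φ := φ') ν (le_max_right C 0) hC'
  have hC₁' : ∀ y, ‖blockCT (le_refl (k + l)) k ν φ' y‖ ≤ max C₁ 0 * (1 ⊔ adelicHeightGL (k + l) K y) ^ r := by
    intro y
    have h0 : (0 : ℝ) ≤ (1 ⊔ adelicHeightGL (k + l) K y) ^ r := pow_nonneg (zero_le_one.trans le_sup_left) r
    exact (hC₁ y).trans (mul_le_mul_of_nonneg_right (le_max_left C₁ 0) h0)
  obtain ⟨C₂, hC₂⟩ := exists_norm_leviFunLeft_le (ψ := blockCT (le_refl (k + l)) k ν φ') (le_max_right C₁ 0) hC₁' m₂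
  refine ⟨C₂, r, fun g => ?_⟩
  rw [AutomorphyDatum.gl_height]
  exact hC₂ g

omit [BorelSpace (AdeleRing (𝓞 K) K)] in
/-- **The second Levi function of a constant term of an automorphic form has moderate growth.**
[cite: MoeglinWaldspurger1995, I.2.17] -/
theorem hasModerateGrowth_leviFunRight_blockCT [NeZero k] [NeZero l] {hcpt : isCompact_glFiniteIntegralLevel (k + l) K}
    {φ' : GL (Fin (k + l)) (AdeleRing (𝓞 K) K) → ℂ} (hφ'a : IsAutomorphicForm (AutomorphyDatum.gl (k + l) K hcpt) φ')
    (ν : Measure (BlockIdx (k + l) k → AdeleRing (𝓞 K) K)) [ν.IsAddHaarMeasure] (m₁ : GL (Fin k) (AdeleRing (𝓞 K) K)) :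
    HasModerateGrowth (AutomorphyDatum.gl l K (isCompact_glFiniteIntegralLevel_holds l K))
      (leviFunRight (blockCT (le_refl (k + l)) k ν φ') m₁) := by
  obtain ⟨C, r, hC⟩ := hφ'a.moderateGrowth
  have hC' : ∀ g, ‖φ' g‖ ≤ max C 0 * (1 ⊔ adelicHeightGL (k + l) K g) ^ r := by
    intro g
    have h1 : ‖φ' g‖ ≤ C * (1 ⊔ adelicHeightGL (k + l) K g) ^ r := by
      have h := hC g
      rw [AutomorphyDatum.gl_height] at h
      exact h
    have h0 : (0 : ℝ) ≤ (1 ⊔ adelicHeightGL (k + l) K g) ^ r := pow_nonneg (zero_le_one.trans le_sup_left) r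
    exact h1.trans (mul_le_mul_of_nonneg_right (le_max_left C 0) h0)
  obtain ⟨C₁, hC₁⟩ := exists_norm_blockCT_le (n := k + l) (k := k) (φ := φ') ν (le_max_right C 0) hC'
  have hC₁' : ∀ y, ‖blockCT (le_refl (k + l)) k ν φ' y‖ ≤ max C₁ 0 * (1 ⊔ adelicHeightGL (k + l) K y) ^ r := by
    intro y
    have h0 : (0 : ℝ) ≤ (1 ⊔ adelicHeightGL (k + l) K y) ^ r := pow_nonneg (zero_le_one.trans le_sup_left) r
    exact (hC₁ y).trans (mul_le_mul_of_nonneg_right (le_max_left C₁ 0) h0)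
  obtain ⟨C₂, hC₂⟩ := exists_norm_leviFunRight_le (ψ := blockCT (le_refl (k + l)) k ν φ') (le_max_right C₁ 0) hC₁' m₁
  refine ⟨C₂, r, fun g => ?_⟩
  rw [AutomorphyDatum.gl_height]
  exact hC₂ g

-- the conversions between the `ofK`/`Adelic` and `ofInfinite`/`GL` forms of the slice conditions are
-- definitional but slow
set_option maxHeartbeats 800000 in
/-- **The first Levi function of the constant term of a translate of an element of `S(U, θ, M)` lies
in the set of the ideal form of the finiteness theorem on `GL_k`** (for the level
`leviLevelLeft (κ U₀ κ⁻¹)`, the ideal `J` of `exists_ideal_forall_leviFunLeft` for the character of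
the translate, and the slice space `M ∘ leviKLeft`): it is an automorphic form on `GL_k(𝔸_K)`
(`LeviConstantTermForms`, `isZFinite_of_ideal`) with these invariants. Moeglin–Waldspurger 1995,
I.2.17; Borel–Jacquet 1979, 4.4. [cite: MoeglinWaldspurger1995, I.2.17] -/
theorem leviFunLeft_blockCT_translateKF_mem [NeZero k] [NeZero l] {hcpt : isCompact_glFiniteIntegralLevel (k + l) K}
    {U₀ : Subgroup (GL (Fin (k + l)) (FiniteAdeleRing (𝓞 K) K))}
    (hU₀o : IsOpen (U₀ : Set (GL (Fin (k + l)) (FiniteAdeleRing (𝓞 K) K))))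
    (hU₀c : IsCompact (U₀ : Set (GL (Fin (k + l)) (FiniteAdeleRing (𝓞 K) K))))
    {θ : centerU (archGroupGL (k + l) K) →ₐ[ℝ] ℂ} {M : Submodule ℂ (Kinf (k + l) K → ℂ)} [FiniteDimensional ℂ M]
    (hM : ∀ k₀ : Kinf (k + l) K, ∀ f ∈ M, (fun c => f (c * k₀)) ∈ M)
    {φ : GL (Fin (k + l)) (AdeleRing (𝓞 K) K) → ℂ} (hφ : φ ∈ hcSet hcpt (U₀.map (GLn.ofFinite (k + l) K)) θ M)
    (κ : GL (Fin (k + l)) (FiniteAdeleRing (𝓞 K) K)) (x : Kinf (k + l) K)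
    (ν : Measure (BlockIdx (k + l) k → AdeleRing (𝓞 K) K)) [ν.IsAddHaarMeasure]
    {J : Ideal (centerU (archGroupGL k K))} [FiniteDimensional ℝ (centerU (archGroupGL k K) ⧸ J)]
    (hJ : ∀ (φ' : (AdelicGroupData.gl (k + l) K).Adelic → ℂ), IsAutomorphicForm (AutomorphyDatum.gl (k + l) K hcpt) φ' →
      HasZCharacter (glArch (k + l) K) φ'
        (θ.comp (adCenterInv (archGroupGL (k + l) K) ⟨(x : GL (Fin (k + l)) (mixedSpace K)), Subgroup.mem_top _⟩)) →
      ∀ (ν' : Measure (BlockIdx (k + l) k → AdeleRing (𝓞 K) K)) [ν'.IsAddHaarMeasure]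
        (m₂ : GL (Fin l) (AdeleRing (𝓞 K) K)) (p : FreeAlgebra ℝ (archGroupGL k K).lie) (hp : IsCentralWord p),
        (⟨freeToEnveloping (archGroupGL k K) p, hp⟩ : centerU (archGroupGL k K)) ∈ J →
          applyFree (glArch k K) p (leviFunLeft (blockCT (le_refl (k + l)) k ν' φ') m₂) = 0)
    (m₂ : GL (Fin l) (AdeleRing (𝓞 K) K)) :
    leviFunLeft (blockCT (le_refl (k + l)) k ν (translateKF φ κ x)) m₂ ∈
      hcJSet (isCompact_glFiniteIntegralLevel_holds k K) (leviLevelLeft k l (U₀.map (MulAut.conj κ).toMonoidHom)) J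
        (M.map (LinearMap.funLeft ℂ ℂ (leviKLeft k l (K := K)))) := by
  obtain ⟨hφ'a, hφ'U, hφ'θ, hφ'M⟩ := translateKF_mem hM hφ κ x
  set φ' := translateKF φ κ x with hφ'_def
  have hφ'c : Continuous φ' := hφ'a.continuous_gl
  obtain ⟨hψs, -, hψθ⟩ := blockCT_smooth_unipotent_character hφ'a hφ'θ ν
  set ψ := blockCT (le_refl (k + l)) k ν φ' with hψ_def
  have hψU : IsRightInvariantUnder ((U₀.map (MulAut.conj κ).toMonoidHom).map (GLn.ofFinite (k + l) K)) ψ :=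
    hφ'U.blockCT (le_refl (k + l)) k ν
  have hψM : ∀ g : GL (Fin (k + l)) (AdeleRing (𝓞 K) K),
      (fun c : Kinf (k + l) K => ψ (g * GLn.ofInfinite (k + l) K (c : GL (Fin (k + l)) (mixedSpace K)))) ∈ M :=
    fun g => IsLeftInvariant.blockCT_slice_mem (hcpt := hcpt) M hφ'c hφ'a.leftInvariant hφ'M ν g
  set L := leviFunLeft ψ m₂ with hL_def
  have hLs : IsArchSmooth (glArch k K) L := isArchSmooth_leviFunLeft hψs m₂
  have hLM : ∀ g₁ : GL (Fin k) (AdeleRing (𝓞 K) K),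
      (fun c : Kinf k K => L (g₁ * GLn.ofInfinite k K (c : GL (Fin k) (mixedSpace K)))) ∈
        M.map (LinearMap.funLeft ℂ ℂ (leviKLeft k l (K := K))) :=
    fun g₁ => leviFunLeft_slice_mem M hψM m₂ g₁
  have hLJ : ∀ (p : FreeAlgebra ℝ (archGroupGL k K).lie) (hp : IsCentralWord p),
      (⟨freeToEnveloping (archGroupGL k K) p, hp⟩ : centerU (archGroupGL k K)) ∈ J →
        applyFree (glArch k K) p L = 0 :=
    fun p hp hpJ => hJ φ' hφ'a hφ'θ ν m₂ p hp hpJ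
  have hLg := hasModerateGrowth_leviFunLeft_blockCT hφ'a ν m₂
  obtain ⟨hUo, hUc⟩ := isOpen_isCompact_map_conj hU₀o hU₀c κ
  have hLa : IsAutomorphicForm (AutomorphyDatum.gl k K (isCompact_glFiniteIntegralLevel_holds k K)) L :=
    { leftInvariant := IsLeftInvariant.leviFunLeft_blockCT hφ'c hφ'a.leftInvariant ν m₂
      exists_level := ⟨leviLevelLeft k l (U₀.map (MulAut.conj κ).toMonoidHom),
        leviLevelLeft_mem hUo hUc, isRightInvariantUnder_leviLevelLeft hψU m₂⟩
      archSmooth := hLs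
      kFinite := isKFinite_of_forall_slice_mem _ hLM
      zFinite := isZFinite_of_ideal (glArch k K) hLs J hLJ
      moderateGrowth := hLg }
  exact ⟨hLa, isRightInvariantUnder_leviLevelLeft hψU m₂, hLJ, hLM⟩

-- the conversions between the `ofK`/`Adelic` and `ofInfinite`/`GL` forms of the slice conditions are
-- definitional but slow
set_option maxHeartbeats 800000 in
/-- **The second Levi function of the constant term of a translate of an element of `S(U, θ, M)` lies
in the set of the ideal form of the finiteness theorem on `GL_l`.** [cite: MoeglinWaldspurger1995, I.2.17] -/
theorem leviFunRight_blockCT_translateKF_mem [NeZero k] [NeZero l] {hcpt : isCompact_glFiniteIntegralLevel (k + l) K}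
    {U₀ : Subgroup (GL (Fin (k + l)) (FiniteAdeleRing (𝓞 K) K))}
    (hU₀o : IsOpen (U₀ : Set (GL (Fin (k + l)) (FiniteAdeleRing (𝓞 K) K))))
    (hU₀c : IsCompact (U₀ : Set (GL (Fin (k + l)) (FiniteAdeleRing (𝓞 K) K))))
    {θ : centerU (archGroupGL (k + l) K) →ₐ[ℝ] ℂ} {M : Submodule ℂ (Kinf (k + l) K → ℂ)} [FiniteDimensional ℂ M]
    (hM : ∀ k₀ : Kinf (k + l) K, ∀ f ∈ M, (fun c => f (c * k₀)) ∈ M)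
    {φ : GL (Fin (k + l)) (AdeleRing (𝓞 K) K) → ℂ} (hφ : φ ∈ hcSet hcpt (U₀.map (GLn.ofFinite (k + l) K)) θ M)
    (κ : GL (Fin (k + l)) (FiniteAdeleRing (𝓞 K) K)) (x : Kinf (k + l) K)
    (ν : Measure (BlockIdx (k + l) k → AdeleRing (𝓞 K) K)) [ν.IsAddHaarMeasure]
    {J : Ideal (centerU (archGroupGL l K))} [FiniteDimensional ℝ (centerU (archGroupGL l K) ⧸ J)]
    (hJ : ∀ (φ' : (AdelicGroupData.gl (k + l) K).Adelic → ℂ), IsAutomorphicForm (AutomorphyDatum.gl (k + l) K hcpt) φ' →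
      HasZCharacter (glArch (k + l) K) φ'
        (θ.comp (adCenterInv (archGroupGL (k + l) K) ⟨(x : GL (Fin (k + l)) (mixedSpace K)), Subgroup.mem_top _⟩)) →
      ∀ (ν' : Measure (BlockIdx (k + l) k → AdeleRing (𝓞 K) K)) [ν'.IsAddHaarMeasure]
        (m₁ : GL (Fin k) (AdeleRing (𝓞 K) K)) (p : FreeAlgebra ℝ (archGroupGL l K).lie) (hp : IsCentralWord p),
        (⟨freeToEnveloping (archGroupGL l K) p, hp⟩ : centerU (archGroupGL l K)) ∈ J →
          applyFree (glArch l K) p (leviFunRight (blockCT (le_refl (k + l)) k ν' φ') m₁) = 0)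
    (m₁ : GL (Fin k) (AdeleRing (𝓞 K) K)) :
    leviFunRight (blockCT (le_refl (k + l)) k ν (translateKF φ κ x)) m₁ ∈
      hcJSet (isCompact_glFiniteIntegralLevel_holds l K) (leviLevelRight k l (U₀.map (MulAut.conj κ).toMonoidHom)) J
        (M.map (LinearMap.funLeft ℂ ℂ (leviKRight k l (K := K)))) := by
  obtain ⟨hφ'a, hφ'U, hφ'θ, hφ'M⟩ := translateKF_mem hM hφ κ x
  set φ' := translateKF φ κ x with hφ'_def
  have hφ'c : Continuous φ' := hφ'a.continuous_gl
  obtain ⟨hψs, -, hψθ⟩ := blockCT_smooth_unipotent_character hφ'a hφ'θ ν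
  set ψ := blockCT (le_refl (k + l)) k ν φ' with hψ_def
  have hψU : IsRightInvariantUnder ((U₀.map (MulAut.conj κ).toMonoidHom).map (GLn.ofFinite (k + l) K)) ψ :=
    hφ'U.blockCT (le_refl (k + l)) k ν
  have hψM : ∀ g : GL (Fin (k + l)) (AdeleRing (𝓞 K) K),
      (fun c : Kinf (k + l) K => ψ (g * GLn.ofInfinite (k + l) K (c : GL (Fin (k + l)) (mixedSpace K)))) ∈ M :=
    fun g => IsLeftInvariant.blockCT_slice_mem (hcpt := hcpt) M hφ'c hφ'a.leftInvariant hφ'M ν g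
  set L := leviFunRight ψ m₁ with hL_def
  have hLs : IsArchSmooth (glArch l K) L := isArchSmooth_leviFunRight hψs m₁
  have hLM : ∀ g₂ : GL (Fin l) (AdeleRing (𝓞 K) K),
      (fun c : Kinf l K => L (g₂ * GLn.ofInfinite l K (c : GL (Fin l) (mixedSpace K)))) ∈
        M.map (LinearMap.funLeft ℂ ℂ (leviKRight k l (K := K))) :=
    fun g₂ => leviFunRight_slice_mem M hψM m₁ g₂
  have hLJ : ∀ (p : FreeAlgebra ℝ (archGroupGL l K).lie) (hp : IsCentralWord p),
      (⟨freeToEnveloping (archGroupGL l K) p, hp⟩ : centerU (archGroupGL l K)) ∈ J →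
        applyFree (glArch l K) p L = 0 :=
    fun p hp hpJ => hJ φ' hφ'a hφ'θ ν m₁ p hp hpJ
  have hLg := hasModerateGrowth_leviFunRight_blockCT hφ'a ν m₁
  obtain ⟨hUo, hUc⟩ := isOpen_isCompact_map_conj hU₀o hU₀c κ
  have hLa : IsAutomorphicForm (AutomorphyDatum.gl l K (isCompact_glFiniteIntegralLevel_holds l K)) L :=
    { leftInvariant := IsLeftInvariant.leviFunRight_blockCT hφ'c hφ'a.leftInvariant ν m₁
      exists_level := ⟨leviLevelRight k l (U₀.map (MulAut.conj κ).toMonoidHom),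
        leviLevelRight_mem hUo hUc, isRightInvariantUnder_leviLevelRight hψU m₁⟩
      archSmooth := hLs
      kFinite := isKFinite_of_forall_slice_mem _ hLM
      zFinite := isZFinite_of_ideal (glArch l K) hLs J hLJ
      moderateGrowth := hLg }
  exact ⟨hLa, isRightInvariantUnder_leviLevelRight hψU m₁, hLJ, hLM⟩

end Levi

/-! ### 5. The constant terms of `S(U, θ, M)` along `P_k` span a finite-dimensional space -/

section Range

variable [MeasurableSpace (AdeleRing (𝓞 K) K)] [BorelSpace (AdeleRing (𝓞 K) K)] {k l : ℕ}

/-- The section functions `F_{κ,t}(m₁, m₂) = ψ (diag(m₁, m₂) · (1, κ) · (x_t, 1))` of a function `ψ` on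
`GL_{k+l}(𝔸_K)`. [folklore] -/
def leviSection (ψ : GL (Fin (k + l)) (AdeleRing (𝓞 K) K) → ℂ) (κ : GL (Fin (k + l)) (FiniteAdeleRing (𝓞 K) K))
    (x : Kinf (k + l) K) : GL (Fin k) (AdeleRing (𝓞 K) K) → GL (Fin l) (AdeleRing (𝓞 K) K) → ℂ :=
  fun m₁ m₂ => ψ (leviGL (AdeleRing (𝓞 K) K) k l (m₁, m₂) *
    (GLn.ofFinite (k + l) K κ * GLn.ofInfinite (k + l) K (x : GL (Fin (k + l)) (mixedSpace K))))

omit [MeasurableSpace (AdeleRing (𝓞 K) K)] [BorelSpace (AdeleRing (𝓞 K) K)] in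
/-- Unfolding of `leviSection`. [folklore] -/
theorem leviSection_apply (ψ : GL (Fin (k + l)) (AdeleRing (𝓞 K) K) → ℂ) (κ : GL (Fin (k + l)) (FiniteAdeleRing (𝓞 K) K))
    (x : Kinf (k + l) K) (m₁ : GL (Fin k) (AdeleRing (𝓞 K) K)) (m₂ : GL (Fin l) (AdeleRing (𝓞 K) K)) :
    leviSection ψ κ x m₁ m₂ = ψ (leviGL (AdeleRing (𝓞 K) K) k l (m₁, m₂) *
      (GLn.ofFinite (k + l) K κ * GLn.ofInfinite (k + l) K (x : GL (Fin (k + l)) (mixedSpace K)))) :=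
  rfl

omit [BorelSpace (AdeleRing (𝓞 K) K)] in
/-- The sections of a constant term are the Levi functions of the constant term of the translate.
[folklore] -/
theorem leviSection_blockCT (ν : Measure (BlockIdx (k + l) k → AdeleRing (𝓞 K) K))
    (φ : GL (Fin (k + l)) (AdeleRing (𝓞 K) K) → ℂ) (κ : GL (Fin (k + l)) (FiniteAdeleRing (𝓞 K) K)) (x : Kinf (k + l) K) :
    leviSection (blockCT (le_refl (k + l)) k ν φ) κ x =
      fun m₁ m₂ => blockCT (le_refl (k + l)) k ν (translateKF φ κ x) (leviGL (AdeleRing (𝓞 K) K) k l (m₁, m₂)) := by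
  funext m₁ m₂
  rw [leviSection_apply]
  exact (blockCT_comp_mul_right (le_refl (k + l)) k ν φ _ _).symm

-- many definitional conversions between the `Adelic` and `GL` forms; the proof is long but elementary
set_option maxHeartbeats 1600000 in
/-- **The constant terms along `P_k` of the elements of `S(U, θ, M)` span a finite-dimensional space**
(`n = k + l`, `k, l ≥ 1`, given the finiteness theorem in the ideal form on `GL_k` and `GL_l`).
Each `φ_P` (`φ ∈ S(U, θ, M)`) is left `N(𝔸)`-invariant, right `U`-invariant with `K_∞`-slices in `M`,
and its sections `F_{κ,t}(m₁, m₂) = φ_P(diag(m₁, m₂) κ x_t)` (finitely many `κ`,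
`exists_finset_coset_representatives`; finitely many `x_t` detecting `M`,
`exists_points_eval_injective`) have partial functions in fixed finite-dimensional spaces of
automorphic forms on `GL_k` and `GL_l` (`leviFunLeft_blockCT_translateKF_mem` and the induction
hypothesis), hence lie in a finite-dimensional space (`finiteDimensional_span_setOf_sections`); and a
function with these invariances is determined by its sections (`GL = N M K_∞ GL(𝒪̂)`,
`exists_unipotent_leviGL_maximalCompact_eq`). Harish-Chandra 1968, §4; Moeglin–Waldspurger 1995,
I.2.17; Borel–Jacquet 1979, 4.3–4.4. [cite: MoeglinWaldspurger1995, I.2.17] -/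
theorem finiteDimensional_span_image_blockCT [NeZero k] [NeZero l] (hcpt : isCompact_glFiniteIntegralLevel (k + l) K)
    (IHk : harishChandra_finiteness (isCompact_glFiniteIntegralLevel_holds k K))
    (IHl : harishChandra_finiteness (isCompact_glFiniteIntegralLevel_holds l K))
    {U₀ : Subgroup (GL (Fin (k + l)) (FiniteAdeleRing (𝓞 K) K))}
    (hU₀o : IsOpen (U₀ : Set (GL (Fin (k + l)) (FiniteAdeleRing (𝓞 K) K))))
    (hU₀c : IsCompact (U₀ : Set (GL (Fin (k + l)) (FiniteAdeleRing (𝓞 K) K))))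
    (θ : centerU (archGroupGL (k + l) K) →ₐ[ℝ] ℂ) (M : Submodule ℂ (Kinf (k + l) K → ℂ)) [FiniteDimensional ℂ M]
    (hM : ∀ k₀ : Kinf (k + l) K, ∀ f ∈ M, (fun c => f (c * k₀)) ∈ M)
    (ν : Measure (BlockIdx (k + l) k → AdeleRing (𝓞 K) K)) [ν.IsAddHaarMeasure] :
    FiniteDimensional ℂ (Submodule.span ℂ
      ((fun φ : GL (Fin (k + l)) (AdeleRing (𝓞 K) K) → ℂ => blockCT (le_refl (k + l)) k ν φ) ''
        hcSet hcpt (U₀.map (GLn.ofFinite (k + l) K)) θ M)) := by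
  -- coset representatives and evaluation points
  obtain ⟨s, hsK, hscov⟩ := exists_finset_coset_representatives (n := k + l) hU₀o
  obtain ⟨d, x, -, hx⟩ := exists_points_eval_injective M
  -- the ideals on the Levi factors, one for each evaluation point
  have hJk := fun t : Fin d => exists_ideal_forall_leviFunLeft (hcpt := hcpt) (k := k) (l := l)
    (θ.comp (adCenterInv (archGroupGL (k + l) K) ⟨(x t : GL (Fin (k + l)) (mixedSpace K)), Subgroup.mem_top _⟩))
  choose Jk hJkfin hJkkill using hJk
  have hJl := fun t : Fin d => exists_ideal_forall_leviFunRight (hcpt := hcpt) (k := k) (l := l)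
    (θ.comp (adCenterInv (archGroupGL (k + l) K) ⟨(x t : GL (Fin (k + l)) (mixedSpace K)), Subgroup.mem_top _⟩))
  choose Jl hJlfin hJlkill using hJl
  -- the slice spaces on the Levi factors
  set Mk : Submodule ℂ (Kinf k K → ℂ) := M.map (LinearMap.funLeft ℂ ℂ (leviKLeft k l (K := K))) with hMk
  set Ml : Submodule ℂ (Kinf l K → ℂ) := M.map (LinearMap.funLeft ℂ ℂ (leviKRight k l (K := K))) with hMl
  have hMk' : ∀ c₀ : Kinf k K, ∀ f ∈ Mk, (fun c => f (c * c₀)) ∈ Mk := map_funLeft_leviKLeft_stable hM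
  have hMl' : ∀ c₀ : Kinf l K, ∀ f ∈ Ml, (fun c => f (c * c₀)) ∈ Ml := map_funLeft_leviKRight_stable hM
  -- the finite-dimensional spaces `A` (on `GL_k`) and `B` (on `GL_l`)
  set A : Submodule ℂ (GL (Fin k) (AdeleRing (𝓞 K) K) → ℂ) := ⨆ p : s × Fin d,
    Submodule.span ℂ (hcJSet (isCompact_glFiniteIntegralLevel_holds k K)
      (leviLevelLeft k l (U₀.map (MulAut.conj (p.1 : GL (Fin (k + l)) (FiniteAdeleRing (𝓞 K) K))).toMonoidHom)) (Jk p.2) Mk) with hA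
  set B : Submodule ℂ (GL (Fin l) (AdeleRing (𝓞 K) K) → ℂ) := ⨆ p : s × Fin d,
    Submodule.span ℂ (hcJSet (isCompact_glFiniteIntegralLevel_holds l K)
      (leviLevelRight k l (U₀.map (MulAut.conj (p.1 : GL (Fin (k + l)) (FiniteAdeleRing (𝓞 K) K))).toMonoidHom)) (Jl p.2) Ml) with hB
  haveI hAfin : ∀ p : s × Fin d, FiniteDimensional ℂ (Submodule.span ℂ (hcJSet (isCompact_glFiniteIntegralLevel_holds k K)
      (leviLevelLeft k l (U₀.map (MulAut.conj (p.1 : GL (Fin (k + l)) (FiniteAdeleRing (𝓞 K) K))).toMonoidHom)) (Jk p.2) Mk)) := by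
    intro p
    haveI := hJkfin p.2
    obtain ⟨hUo, hUc⟩ := isOpen_isCompact_map_conj hU₀o hU₀c (p.1 : GL (Fin (k + l)) (FiniteAdeleRing (𝓞 K) K))
    exact finiteDimensional_span_hcJSet IHk (leviLevelLeft_mem hUo hUc) (Jk p.2) Mk hMk'
  haveI hBfin : ∀ p : s × Fin d, FiniteDimensional ℂ (Submodule.span ℂ (hcJSet (isCompact_glFiniteIntegralLevel_holds l K)
      (leviLevelRight k l (U₀.map (MulAut.conj (p.1 : GL (Fin (k + l)) (FiniteAdeleRing (𝓞 K) K))).toMonoidHom)) (Jl p.2) Ml)) := by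
    intro p
    haveI := hJlfin p.2
    obtain ⟨hUo, hUc⟩ := isOpen_isCompact_map_conj hU₀o hU₀c (p.1 : GL (Fin (k + l)) (FiniteAdeleRing (𝓞 K) K))
    exact finiteDimensional_span_hcJSet IHl (leviLevelRight_mem hUo hUc) (Jl p.2) Ml hMl'
  haveI hA' : FiniteDimensional ℂ A := @Submodule.finiteDimensional_iSup ℂ _ _ _ _ (s × Fin d) _ _ hAfin
  haveI hB' : FiniteDimensional ℂ B := @Submodule.finiteDimensional_iSup ℂ _ _ _ _ (s × Fin d) _ _ hBfin
  -- the space of sections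
  set T : Submodule ℂ (GL (Fin k) (AdeleRing (𝓞 K) K) → GL (Fin l) (AdeleRing (𝓞 K) K) → ℂ) :=
    Submodule.span ℂ {f | (∀ m₂, (fun m₁ => f m₁ m₂) ∈ A) ∧ ∀ m₁, f m₁ ∈ B} with hT
  haveI hTfin : FiniteDimensional ℂ T := (finiteDimensional_span_setOf_sections A B).1
  -- the functions with the invariances of a constant term and sections in `T`
  let V : Submodule ℂ (GL (Fin (k + l)) (AdeleRing (𝓞 K) K) → ℂ) :=
    { carrier := {ψ | (∀ (Y : blockNilpotent (k + l) k (AdeleRing (𝓞 K) K)) (g : GL (Fin (k + l)) (AdeleRing (𝓞 K) K)),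
          ψ (unipotentOfBlock (k + l) k (AdeleRing (𝓞 K) K) (Multiplicative.ofAdd Y) * g) = ψ g) ∧
        IsRightInvariantUnder (U₀.map (GLn.ofFinite (k + l) K)) ψ ∧
        (∀ g : GL (Fin (k + l)) (AdeleRing (𝓞 K) K),
          (fun c : Kinf (k + l) K => ψ (g * GLn.ofInfinite (k + l) K (c : GL (Fin (k + l)) (mixedSpace K)))) ∈ M) ∧
        ∀ p : s × Fin d, leviSection ψ (p.1 : GL (Fin (k + l)) (FiniteAdeleRing (𝓞 K) K)) (x p.2) ∈ T}
      zero_mem' := ⟨fun _ _ => rfl, fun _ _ _ => rfl, fun _ => M.zero_mem, fun _ => T.zero_mem⟩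
      add_mem' := fun {ψ₁ ψ₂} h₁ h₂ => ⟨fun Y g => by simp only [Pi.add_apply, h₁.1 Y g, h₂.1 Y g],
        fun u hu g => by simp only [Pi.add_apply, h₁.2.1 u hu g, h₂.2.1 u hu g],
        fun g => M.add_mem (h₁.2.2.1 g) (h₂.2.2.1 g), fun p => T.add_mem (h₁.2.2.2 p) (h₂.2.2.2 p)⟩
      smul_mem' := fun c ψ h => ⟨fun Y g => by simp only [Pi.smul_apply, h.1 Y g],
        fun u hu g => by simp only [Pi.smul_apply, h.2.1 u hu g],
        fun g => M.smul_mem c (h.2.2.1 g), fun p => T.smul_mem c (h.2.2.2 p)⟩ }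
  -- the constant terms of the elements of `S(U, θ, M)` lie in `V`
  have hgen : (fun φ : GL (Fin (k + l)) (AdeleRing (𝓞 K) K) → ℂ => blockCT (le_refl (k + l)) k ν φ) ''
      hcSet hcpt (U₀.map (GLn.ofFinite (k + l) K)) θ M ⊆ V := by
    rintro _ ⟨φ, hφ, rfl⟩
    have hφc : Continuous φ := hφ.1.continuous_gl
    have hφM : ∀ g : GL (Fin (k + l)) (AdeleRing (𝓞 K) K),
        (fun c : Kinf (k + l) K => φ (g * GLn.ofInfinite (k + l) K (c : GL (Fin (k + l)) (mixedSpace K)))) ∈ M :=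
      fun g => hφ.2.2.2 g
    refine ⟨fun Y g => IsLeftInvariant.blockCT_unipotentOfBlock_mul hφc hφ.1.leftInvariant ν Y g,
      hφ.2.1.blockCT _ k ν, fun g => IsLeftInvariant.blockCT_slice_mem (hcpt := hcpt) M hφc hφ.1.leftInvariant hφM ν g,
      fun p => ?_⟩
    rw [leviSection_blockCT]
    refine Submodule.subset_span ⟨fun m₂ => ?_, fun m₁ => ?_⟩
    · have hmem := leviFunLeft_blockCT_translateKF_mem hU₀o hU₀c hM hφ (p.1 : GL (Fin (k + l)) (FiniteAdeleRing (𝓞 K) K))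
        (x p.2) ν (J := Jk p.2) (hJkkill p.2) m₂
      exact Submodule.mem_iSup_of_mem p (Submodule.subset_span hmem)
    · have hmem := leviFunRight_blockCT_translateKF_mem hU₀o hU₀c hM hφ (p.1 : GL (Fin (k + l)) (FiniteAdeleRing (𝓞 K) K))
        (x p.2) ν (J := Jl p.2) (hJlkill p.2) m₁
      exact Submodule.mem_iSup_of_mem p (Submodule.subset_span hmem)
  have hle : Submodule.span ℂ ((fun φ : GL (Fin (k + l)) (AdeleRing (𝓞 K) K) → ℂ => blockCT (le_refl (k + l)) k ν φ) ''
      hcSet hcpt (U₀.map (GLn.ofFinite (k + l) K)) θ M) ≤ V := Submodule.span_le.2 hgen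
  -- `V` is finite-dimensional: the section map is injective on `V`
  let E : V →ₗ[ℂ] ((s × Fin d) → T) :=
    { toFun := fun ψ p => ⟨leviSection (ψ : GL (Fin (k + l)) (AdeleRing (𝓞 K) K) → ℂ) (p.1 : GL (Fin (k + l)) (FiniteAdeleRing (𝓞 K) K)) (x p.2), ψ.2.2.2.2 p⟩
      map_add' := fun ψ₁ ψ₂ => by funext p; rfl
      map_smul' := fun c ψ => by funext p; rfl }
  have hE : Function.Injective E := by
    rw [← LinearMap.ker_eq_bot, LinearMap.ker_eq_bot']
    intro ψ hψ0
    obtain ⟨hN, hU, hMψ, -⟩ := ψ.2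
    refine Subtype.ext (funext fun g => ?_)
    -- decompose `g = u · diag(m₁, m₂) · (κ, 1) · (1, κ_f)`, `κ_f = κ_i u'`
    obtain ⟨Y, m₁, m₂, κ, κf, hκf, hg⟩ := exists_unipotent_leviGL_maximalCompact_eq g
    obtain ⟨κi, hκi, u, hu, hκfu⟩ := hscov κf hκf
    set y := leviGL (AdeleRing (𝓞 K) K) k l (m₁, m₂) * GLn.ofFinite (k + l) K κi with hy
    have h1 : (ψ : GL (Fin (k + l)) (AdeleRing (𝓞 K) K) → ℂ) g =
        (ψ : GL (Fin (k + l)) (AdeleRing (𝓞 K) K) → ℂ) (y * GLn.ofInfinite (k + l) K (κ : GL (Fin (k + l)) (mixedSpace K))) := by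
      have e1 : g = unipotentOfBlock (k + l) k (AdeleRing (𝓞 K) K) (Multiplicative.ofAdd Y) *
          (y * GLn.ofInfinite (k + l) K (κ : GL (Fin (k + l)) (mixedSpace K)) * GLn.ofFinite (k + l) K u) := by
        rw [hg, hκfu, map_mul, hy]
        simp only [mul_assoc]
        rw [← mul_assoc (GLn.ofInfinite (k + l) K (κ : GL (Fin (k + l)) (mixedSpace K))) (GLn.ofFinite (k + l) K κi),
          (GLn.commute_ofInfinite_ofFinite (κ : GL (Fin (k + l)) (mixedSpace K)) κi).eq, mul_assoc]
      rw [e1, hN, hU _ ⟨u, hu, rfl⟩]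
    -- the slice through `y` vanishes at the evaluation points, hence everywhere
    have hslice := hMψ y
    have hzero : (fun c : Kinf (k + l) K => (ψ : GL (Fin (k + l)) (AdeleRing (𝓞 K) K) → ℂ)
        (y * GLn.ofInfinite (k + l) K (c : GL (Fin (k + l)) (mixedSpace K)))) = 0 := by
      refine hx _ hslice fun t => ?_
      have ht := congr_fun hψ0 (⟨κi, hκi⟩, t)
      rw [Pi.zero_apply] at ht
      have ht' := congr_fun (congr_fun (congrArg Subtype.val ht) m₁) m₂
      change leviSection (ψ : GL (Fin (k + l)) (AdeleRing (𝓞 K) K) → ℂ) κi (x t) m₁ m₂ = 0 at ht'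
      rw [leviSection_apply] at ht'
      rw [← ht', hy, mul_assoc]
    have h2 := congr_fun hzero κ
    rw [Pi.zero_apply] at h2
    rw [h1, h2]
    rfl
  haveI : FiniteDimensional ℂ V := FiniteDimensional.of_injective E hE
  exact Submodule.finiteDimensional_of_le hle

end Range

/-! ### 6. The induction -/

section Assembly

variable [MeasurableSpace (AdeleRing (𝓞 K) K)] [BorelSpace (AdeleRing (𝓞 K) K)]

/-- The range finiteness for a maximal parabolic `P_{k'}`, `0 < k' < n`, of `GL_n` (transport of
`finiteDimensional_span_image_blockCT` along `n = k' + (n - k')`). [cite: MoeglinWaldspurger1995, I.2.17] -/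
theorem finiteDimensional_span_image_blockCT' {n : ℕ} (hcpt : isCompact_glFiniteIntegralLevel n K)
    (IH : ∀ m < n, ∀ hc : isCompact_glFiniteIntegralLevel m K, harishChandra_finiteness hc)
    {U₀ : Subgroup (GL (Fin n) (FiniteAdeleRing (𝓞 K) K))}
    (hU₀o : IsOpen (U₀ : Set (GL (Fin n) (FiniteAdeleRing (𝓞 K) K))))
    (hU₀c : IsCompact (U₀ : Set (GL (Fin n) (FiniteAdeleRing (𝓞 K) K))))
    (θ : centerU (archGroupGL n K) →ₐ[ℝ] ℂ) (M : Submodule ℂ (Kinf n K → ℂ)) [FiniteDimensional ℂ M]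
    (hM : ∀ k₀ : Kinf n K, ∀ f ∈ M, (fun c => f (c * k₀)) ∈ M) {k' : ℕ} (hk : 0 < k') (hkn : k' < n)
    (ν : Measure (BlockIdx n k' → AdeleRing (𝓞 K) K)) [ν.IsAddHaarMeasure] :
    FiniteDimensional ℂ (Submodule.span ℂ
      ((fun φ : GL (Fin n) (AdeleRing (𝓞 K) K) → ℂ => blockCT (le_refl n) k' ν φ) ''
        hcSet hcpt (U₀.map (GLn.ofFinite n K)) θ M)) := by
  obtain ⟨l', rfl⟩ : ∃ l', n = k' + l' := ⟨n - k', by omega⟩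
  haveI : NeZero k' := ⟨by omega⟩
  haveI : NeZero l' := ⟨by omega⟩
  exact finiteDimensional_span_image_blockCT hcpt (IH k' (by omega) _) (IH l' (by omega) _) hU₀o hU₀c θ M hM ν

/-- **The induction step**: if the finiteness theorem holds in the ideal form on all
`GL_m`, `m < n`, then it holds in the character form on `GL_n`. The space `S(U, θ, M)` maps, by the
constant terms along the `P_k` (`0 < k < n`, a fixed additive Haar measure on each box), linearly to
a finite-dimensional space (`finiteDimensional_span_image_blockCT'`), with kernel the cusp forms of
`S(U, θ, M)` (`cuspConditionGL_of_blockCT_eq_zero`), a finite-dimensional space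
(`finiteDimensional_span_cuspForms_of_hasZCharacter'`). Harish-Chandra 1968, Thm. 1 and §4;
Borel–Jacquet 1979, 4.3 (i); Moeglin–Waldspurger 1995, I.2.17. [cite: BorelJacquet1979, 4.3 (i)] -/
theorem harishChandra_finiteness_gl_step {n : ℕ}
    (IH : ∀ m < n, ∀ hc : isCompact_glFiniteIntegralLevel m K, harishChandra_finiteness hc)
    (hcpt : isCompact_glFiniteIntegralLevel n K) : harishChandra_finiteness_gl hcpt := by
  intro U hU θ M _ hM
  obtain ⟨U₀, hU₀o, hU₀c, rfl⟩ := mem_finiteLevelsGL_iff.1 hU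
  haveI := t2Space_adeleRing K
  haveI := secondCountableTopology_adeleRing K
  haveI := locallyCompactSpace_adeleRing' K
  haveI : ∀ k' : ℕ, BorelSpace (BlockIdx n k' → AdeleRing (𝓞 K) K) := fun _ => Pi.borelSpace
  -- a Haar measure on each box
  let ν : ∀ k' : ℕ, Measure (BlockIdx n k' → AdeleRing (𝓞 K) K) := fun k' => Measure.addHaar
  -- the subspace `W = S(U, θ, M)`
  change FiniteDimensional ℂ (Submodule.span ℂ (hcSet hcpt (U₀.map (GLn.ofFinite n K)) θ M))
  rw [span_hcSet_eq]
  set W := hcSubmodule hcpt (U₀.map (GLn.ofFinite n K)) θ M with hW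
  -- the index set of the maximal parabolics
  let ι₁ := {k' : ℕ // 0 < k' ∧ k' < n}
  haveI : Finite ι₁ := Finite.of_injective (fun i : ι₁ => (⟨i.1, i.2.2⟩ : Fin n))
    (fun a b h => Subtype.ext (Fin.mk.inj_iff.1 h))
  -- the spans of the constant terms, finite-dimensional by the induction hypothesis
  let Vsp : ι₁ → Submodule ℂ (GL (Fin n) (AdeleRing (𝓞 K) K) → ℂ) := fun i =>
    Submodule.span ℂ ((fun φ : GL (Fin n) (AdeleRing (𝓞 K) K) → ℂ => blockCT (le_refl n) i.1 (ν i.1) φ) ''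
      hcSet hcpt (U₀.map (GLn.ofFinite n K)) θ M)
  haveI hV : ∀ i, FiniteDimensional ℂ (Vsp i) := fun i =>
    finiteDimensional_span_image_blockCT' hcpt IH hU₀o hU₀c θ M hM i.2.1 i.2.2 (ν i.1)
  -- the constant term map
  have hint : ∀ (φ : W) (i : ι₁) (y : GL (Fin n) (AdeleRing (𝓞 K) K)),
      IntegrableOn (fun N => (φ : (AdelicGroupData.gl n K).Adelic → ℂ) (glCorner (AdeleRing (𝓞 K) K) (le_refl n)
        (unipotentOfBlock n i.1 (AdeleRing (𝓞 K) K)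
          (Multiplicative.ofAdd (blockMatrixEquiv (AdeleRing (𝓞 K) K) n i.1 N))) * y))
        (piFundamentalDomain K (BlockIdx n i.1)) (ν i.1) := fun φ i y =>
    IsLeftInvariant.integrableOn_blockCT (IsAutomorphicForm.continuous_gl φ.2.1) φ.2.1.leftInvariant (ν i.1) y
  let Φ : W →ₗ[ℂ] (∀ i : ι₁, Vsp i) :=
    { toFun := fun φ i => ⟨blockCT (le_refl n) i.1 (ν i.1) (φ : (AdelicGroupData.gl n K).Adelic → ℂ),
        Submodule.subset_span ⟨_, φ.2, rfl⟩⟩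
      map_add' := fun φ ψ => by
        funext i
        refine Subtype.ext (funext fun y => ?_)
        exact blockCT_add (le_refl n) i.1 (ν i.1) (hint φ i y) (hint ψ i y)
      map_smul' := fun c φ => by
        funext i
        refine Subtype.ext (funext fun y => ?_)
        exact blockCT_smul (le_refl n) i.1 (ν i.1) c _ y }
  -- the kernel consists of cusp forms of level `U`, character `θ`, slices in `M`
  have hker : FiniteDimensional ℂ (LinearMap.ker Φ) := by
    haveI hS₀ := finiteDimensional_span_cuspForms_of_hasZCharacter' (hcpt := hcpt) hU θ M hM
    let j : LinearMap.ker Φ →ₗ[ℂ] Submodule.span ℂ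
        {φ : (AdelicGroupData.gl n K).Adelic → ℂ |
          IsCuspFormGL n K hcpt φ ∧ IsRightInvariantUnder (U₀.map (GLn.ofFinite n K)) φ ∧
          HasZCharacter (AutomorphyDatum.gl n K hcpt).ofArch φ θ ∧
          ∀ g : (AdelicGroupData.gl n K).Adelic,
            (fun c : Kinf n K => φ (g * (AutomorphyDatum.gl n K hcpt).ofK c)) ∈ M} :=
      { toFun := fun φ => ⟨((φ : W) : (AdelicGroupData.gl n K).Adelic → ℂ), Submodule.subset_span (by
          have hφW := (φ : W).2
          have hφ0 : Φ (φ : W) = 0 := (LinearMap.mem_ker).1 φ.2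
          refine ⟨⟨hφW.1, fun k' hk hkn => ?_⟩, hφW.2.1, hφW.2.2.1, hφW.2.2.2⟩
          have h0 := congr_fun hφ0 ⟨k', hk, hkn⟩
          have h0' := congrArg Subtype.val h0
          refine cuspConditionGL_of_blockCT_eq_zero (IsAutomorphicForm.continuous_gl hφW.1) hφW.1.leftInvariant (ν k')
            fun y => ?_
          exact congr_fun h0' y)⟩
        map_add' := fun _ _ => rfl
        map_smul' := fun _ _ => rfl }
    have hj : Function.Injective j := fun φ ψ h =>
      Subtype.ext (Subtype.ext (congrArg (fun z : Submodule.span ℂ _ => (z : (AdelicGroupData.gl n K).Adelic → ℂ)) h))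
    exact FiniteDimensional.of_injective j hj
  -- conclusion: `W` is finite-dimensional
  have hfg : (⊤ : Submodule ℂ W).FG := by
    refine Submodule.fg_of_fg_map_of_fg_inf_ker Φ (IsNoetherian.noetherian _) ?_
    rw [top_inf_eq]
    exact (Submodule.fg_iff_finiteDimensional _).2 hker
  exact Module.finite_def.mpr hfg

omit [MeasurableSpace (AdeleRing (𝓞 K) K)] [BorelSpace (AdeleRing (𝓞 K) K)] in
/-- The finiteness theorem on `GL_0` (a point). [folklore] -/
theorem harishChandra_finiteness_gl_zero (hcpt : isCompact_glFiniteIntegralLevel 0 K) : harishChandra_finiteness_gl hcpt := by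
  intro U hU θ M _ hM
  haveI : Subsingleton (Matrix (Fin 0) (Fin 0) (AdeleRing (𝓞 K) K)) := inferInstance
  haveI : Finite (AdelicGroupData.gl 0 K).Adelic := (show Finite (GL (Fin 0) (AdeleRing (𝓞 K) K)) from inferInstance)
  infer_instance

omit [MeasurableSpace (AdeleRing (𝓞 K) K)] [BorelSpace (AdeleRing (𝓞 K) K)] in
/-- Harish-Chandra's finiteness theorem for all `GL_n / K` by strong induction on `n` (the Borel
σ-algebra on `𝔸_K` is chosen inside the proof). [cite: BorelJacquet1979, 4.3 (i)] -/
theorem harishChandra_finiteness_gl_nat : ∀ (n : ℕ) (hcpt : isCompact_glFiniteIntegralLevel n K), harishChandra_finiteness_gl hcpt := by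
  letI : MeasurableSpace (AdeleRing (𝓞 K) K) := borel _
  haveI : BorelSpace (AdeleRing (𝓞 K) K) := ⟨rfl⟩
  intro n
  induction n using Nat.strong_induction_on with
  | _ n IH =>
    intro hcpt
    rcases Nat.lt_or_ge n 2 with hn | -
    · interval_cases n
      · exact harishChandra_finiteness_gl_zero hcpt
      · exact harishChandra_finiteness_gl_glOne hcpt
    · exact harishChandra_finiteness_gl_step
        (fun m hm hc => harishChandra_finiteness_of_harishChandra_finiteness_gl (IH m hm hc)) hcpt

end Assembly

/-! ### 7. The discharges -/

section Discharge

-- the facts being discharged take the (proved, `isCompact_glFiniteIntegralLevel_holds`) compactness `hcpt` as a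
-- parameter; it is a section variable here so that the discharges are the closed `theorem X_holds : X hcpt`
variable {n : ℕ} (hcpt : isCompact_glFiniteIntegralLevel n K)

/-- **Harish-Chandra's finiteness theorem for `GL_n / K`** (Borel–Jacquet 1979, 4.3 (i);
Harish-Chandra 1968, Thm. 1): **discharge of the named fact `harishChandra_finiteness_gl`** of
`AutomorphicRepsGL` — for a level `U`, a character `θ` of `Z(𝔤)` and a finite-dimensional right
`K_∞`-stable space `M` of functions on `K_∞`, the automorphic forms on `GL_n(𝔸_K)` right invariant
under `U`, of character `θ` and with `K_∞`-slices in `M` span a finite-dimensional space.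
[cite: BorelJacquet1979, 4.3 (i)] -/
theorem harishChandra_finiteness_gl_holds : harishChandra_finiteness_gl hcpt :=
  harishChandra_finiteness_gl_nat n hcpt

/-- **Harish-Chandra's finiteness theorem, ideal form** (`dim 𝒜(U, J, M) < ∞`): discharge of the
named fact `harishChandra_finiteness` of `LangAutomorphicForms`. [cite: BorelJacquet1979, 4.3 (i)] -/
theorem harishChandra_finiteness_holds : harishChandra_finiteness hcpt :=
  harishChandra_finiteness_of_harishChandra_finiteness_gl (harishChandra_finiteness_gl_holds hcpt)

/-- **Automorphic representations of `GL_n(𝔸_K)` are admissible** (Borel–Jacquet 1979, 4.5 with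
4.3 (i)): discharge of the named fact `automorphicRep_isAdmissible` of `LangAutomorphicForms`
(`automorphicRep_isAdmissible_of_harishChandra_finiteness_gl` of `LangAutomorphicFormsAdmissibleProofs`
and Harish-Chandra's finiteness theorem). [cite: BorelJacquet1979, 4.5] -/
theorem automorphicRep_isAdmissible_holds : automorphicRep_isAdmissible hcpt :=
  automorphicRep_isAdmissible_of_harishChandra_finiteness_gl (harishChandra_finiteness_gl_holds hcpt)

end Discharge

end Literature.NumberTheory.Automorphic
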